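import Summits.BirchSwinnertonDyer.BirchSwinnertonDyer.Theorems.AlignedTransportAtTwoRouteLedgerModelsBothSigns
import Summits.BirchSwinnertonDyer.BirchSwinnertonDyer.Theorems.AlignedTransportAtTwoMainConjectureOfRankZeroBSDAtTwoCubicNarrowRankDoorModelsAnyRung
import Literature.NumberTheory.IwasawaTheory.NarrowDefectBoundedOfClassicalMuAdjoinI
import HarnessLib

/-!
# Route `AlignedTransportAtTwo` (cell `bsd-f1-sign2`) — FROM `μ₂ = 0` FOR `ℚ(W[2], √−1)` TO A NARROW RANK RUNG OF `ℚ(β)` AND THE NARROW MODELS CERTIFICATE,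
# per curve (EITHER sign of `Δ_W`), and the ledger consequences: PFμ¹² ⟹ hNarrowModels ⟹ C2 on BOTH signs (no named fact beyond PRINT⁵ + MuIneqʳ)

HONEST FRAMING (cell `bsd-f1-sign2`, WIDTH-5 attach seat `bsd-line-att-p4` g26, route-ledger lane; `--supports stmt-BirchSwinnertonDyer-22298 --as helper`). THEOREMS ONLY
(no `def`, no named fact, no `sorry`, no instance). BSD is NOT proved by this file; C2 is NOT closed (nor refuted); its verdict «blocked-on
`Rank1Residual.GreenbergMuConjectureIrreducible`» is untouched. Part of this seat's «THE NARROW DATUM IS NECESSARY TOO» (g25 RANK-LEDGER §5 (d) / g26 MODELS-LEDGER §6 (ii)):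
the sequel `…RouteLedgerNarrowModelsNecessity` adds the one named print fact (Greenberg 2011 Prop. 4.1.6 at `K′ = ℚ(E[2], √−1)`) that turns `MC₂(W)` into this file's
hypothesis PFμ¹²(W) = «`μ₂ = 0` for every cyclotomic `ℤ₂`-extension of `ℚ(W[2]) ⊔ ℚ⟮i⟯`» (the hypothesis `hμ12` of att-p5's `…SmallCarrierRoad`), and closes the circle
C2 ⟹ PFμ¹² ⟹ hNarrowModels ⟹ C2.

MECHANISM. PFμ¹²(W) ⟹ `μ₂(ℚ(β, i)) = 0` (finite `μ`-descent, Iwasawa 1973 §3, tree `classicalMuVanishes_of_isCyclotomic_of_le_noGrowth`; stated over a general number field `K`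
to avoid the `ℚ`-algebra instance diamond on `ℚ̄`) ⟹ Kida-lite (a) `μ₂(ℚ(β)) = 0` ∧ (b) bounded narrow defect (this seat's Literature
`NarrowDefectBoundedOfClassicalMuAdjoinI`: genus theory with signatures + Hasse's norm theorem, p762738/p762878) ⟹ ONE narrow rung `m ≥ 0` for every cyclotomic
`ℤ₂`-extension of `ℚ(β)` (w2 GEN 11 completeness through this seat's `exists_narrowRung_anyRung_iff_narrowMuData`; Fukuda index `0` on every stratum, att-p5 g28) ⟹ the
narrow models certificate on the layers `L = ℚ(β)_m ⊆ L' = ℚ(β)_{m+1}` (bsd-2adic `exists_iterate_root_layer_of_not_dvd_finrank`, `finrank_layer_holds`).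

* §1 (generic `K`) `classicalMu_pointField_sup_adjoin_of_classicalMu_divisionField_two_sup_adjoin` — `μ₂(K(E[2], i)) = 0 ⟹ μ₂(K̄^{Stab P} ⊔ K⟮i⟯) = 0`.
* §2 (per curve over `ℚ`, EITHER sign, NO named fact) **`narrowMuData_of_classicalMu_divisionField_two_sup_adjoin`** (PFμ¹²(W) ⟹ (a) ∧ (b) for `ℚ(β)`),
  **`exists_narrowRung_of_classicalMu_divisionField_two_sup_adjoin`** (⟹ ONE rung `m ≥ 0` with `[Cl⁺(ℚ(β)_{m+1}) : (Cl⁺)²] = [Cl⁺(ℚ(β)_m) : (Cl⁺)²]` for every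
  cyclotomic `ℤ₂`-extension — EXACTLY the `hcert` of the narrow doors `…CubicNarrowRankDoorModelsAnyRung.mazurMainConjecture_two_of_muIneqRel_of_narrowRung_anyRung`),
  **`exists_narrow_subfield_models_of_classicalMu_divisionField_two_sup_adjoin`** (the same on explicit subfield models).
* §3 (ledger) **`hNarrowModels_of_divisionFieldAdjoinIMu`** (PFμ¹² for every seed-cell curve ⟹ hNarrowModels, BOTH signs) and
  **`mainConjectureOfRankZeroBSDAtTwo_of_named_inputs_narrowModels_bothSigns`** (C2 BY NAME ⟸ PRINT⁵ + MuIneqʳ + hNarrowModels on BOTH signs — the 6th-currency ledger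
  p761955 with the plain binder on `Δ < 0` replaced by the narrow one, which is legitimate on both signs).

PARTITION (D-0171): none moved. Beyond-print theorem: no. BSD is NOT proved; C2 neither proved nor refuted.

References: [Iwasawa1973MuInvariants] §3–§4; [Fukuda1994] Thm. 1 (2), p. 264; [Washington1997] §13.1, §13.3 Prop. 13.22–13.23; [Gras2003] IV.4; [Omeara1963] 65:23;
[Kida1982JFields] (shape); [Kato2004Asterisque] Thm. 17.4 (1)(2); [GreenbergLNM1716] Thm. 4.1, Conj. 1.11; tree p761190/p761191/p761955 (this seat), p757530 (att-p5 g28),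
p762738/p762878 (this seat, Literature).
bears_on: stmt-BirchSwinnertonDyer-22298 (C2) — helper; closes nothing.
-/

set_option linter.dupNamespace false
set_option autoImplicit false

noncomputable section

open scoped MatrixGroups ModularForm NumberField Classical
open CongruenceSubgroup WeierstrassCurve Polynomial NumberField Module Field
open Literature.NumberTheory.EllipticCurves Literature.NumberTheory.EllipticCurves.ModularForms
open Literature.NumberTheory.EllipticCurves.Greenberg1999 Literature.NumberTheory.EllipticCurves.Module
open Literature.NumberTheory.EllipticCurves.Rank1Residual Literature.NumberTheory.EllipticCurves.Rank1Residual.Typed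
open Literature.NumberTheory.GaloisRepresentations Literature.NumberTheory.IwasawaTheory
open Literature.NumberTheory.NumberFields (narrowClassNumber NarrowClassGroup)
open Summit.BirchSwinnertonDyer.Rank1Residual Summit.BirchSwinnertonDyer.Rank1Residual.F1Sign2
open Summit.BirchSwinnertonDyer.Rank1Residual.X1.MuLambda Summit.BirchSwinnertonDyer.Rank1Residual.X5
open Summit.BirchSwinnertonDyer.BirchSwinnertonDyer.Theorems.Rank1ResidualX1Defs
open Summit.BirchSwinnertonDyer.BirchSwinnertonDyer.Theses.AlignedTransportAtTwo
open Summit.BirchSwinnertonDyer.BirchSwinnertonDyer.Theorems.AlignedTransportAtTwoCubicNarrowRankDoor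
  (finrank_adjoin_eq_three_of_forall_not_hasRationalTwoTorsionX)
open Summit.BirchSwinnertonDyer.BirchSwinnertonDyer.Theorems.AlignedTransportAtTwoCubicCarrierRoad
  (mazurMainConjecture_two_of_muIneqRel_of_narrowMu_cubicField)
open Summit.BirchSwinnertonDyer.BirchSwinnertonDyer.Theorems.AlignedTransportAtTwoCubicOffStratumFukudaIndex
  (totallyRamifiedFrom_zero_adjoin_of_isOrdinaryAt_two)
open Summit.BirchSwinnertonDyer.BirchSwinnertonDyer.Theorems.AlignedTransportAtTwoCubicNarrowRankDoorModelsAnyRung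
  (exists_narrowRung_anyRung_iff_narrowMuData)
open Summit.BirchSwinnertonDyer.BirchSwinnertonDyer.Theorems.AlignedTransportAtTwoRouteLedgerModelsBothSigns (narrowMuData_of_subfield_models)
open Summit.BirchSwinnertonDyer.BirchSwinnertonDyer.Theorems.AlignedTransportAtTwoTorsionPointField (finiteDimensional_fixedField_stabilizer)
open Summit.BirchSwinnertonDyer.BirchSwinnertonDyer.Theorems (AnalyticMuTwo.red_ne_zero_of_isEvenBranchLiftAtTwo_of_forall_not_hasRationalTwoTorsionX
  AddKatoTwo.fixedField_stabilizer_le_divisionField_two AddKatoTwo.exists_geomTorsion_two_ne_zero_fixedField_stabilizer_eq_adjoin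
  AddKatoTwo.exists_aeval_twoTorsionPolynomial_eq_zero)

namespace Summit.BirchSwinnertonDyer.BirchSwinnertonDyer.Theorems.AlignedTransportAtTwoRouteLedgerNarrowModelsFromAdjoinIMu

/-! ## §1 Generic base: `μ₂(K(E[2], i)) = 0` descends to `K(P, i)` -/

section Generic

variable {K : Type} [Field K] [NumberField K] (V : WeierstrassCurve K) [V.IsElliptic]

/-- **`μ₂(K(E[2], i)^{cyc}) = 0 ⟹ μ₂(K(P, i)^{cyc}) = 0`** for an elliptic curve `E = V/K` over a number field, a geometric `2`-torsion point `P`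
(`K(P) = K̄^{Stab P}`) and `i ∈ K̄` with `i² = −1`, WITHOUT Iwasawa's growth theorem: `K̄^{Stab P} ≤ K(E[2])` (k4-w1's
`AddKatoTwo.fixedField_stabilizer_le_divisionField_two`), hence `K̄^{Stab P} ⊔ K⟮i⟯ ≤ K(E[2]) ⊔ K⟮i⟯`, and the hI-free finite `μ`-descent
`classicalMuVanishes_of_isCyclotomic_of_le_noGrowth`.  Stated over a general `K` (over `ℚ` instance search meets the `DivisionRing.toRatAlgebra` diamond) and
specialised to `ℚ`, `K̄^{Stab P} = ℚ(β)`, below. [cite: Iwasawa1973MuInvariants, §3 (remark after Thm. 2)] [cite: Washington1997, §13.1] -/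
theorem classicalMu_pointField_sup_adjoin_of_classicalMu_divisionField_two_sup_adjoin (P : geomTorsion V 2)
    {i : AlgebraicClosure K} (hi : i ^ 2 = -1)
    (hμ : ∀ κL : ZpExtension ↥(V.divisionField 2 ⊔ IntermediateField.adjoin K ({i} : Set (AlgebraicClosure K))) 2,
      κL.IsCyclotomic → ClassicalMuVanishes κL) :
    ∀ κP : ZpExtension ↥(IntermediateField.fixedField (MulAction.stabilizer (absoluteGaloisGroup K) P) ⊔
        IntermediateField.adjoin K ({i} : Set (AlgebraicClosure K))) 2, κP.IsCyclotomic → ClassicalMuVanishes κP := by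
  have hint : IsIntegral K i := by
    refine ⟨X ^ 2 + 1, monic_X_pow_add_C _ two_ne_zero, ?_⟩
    simp [hi]
  haveI := IntermediateField.adjoin.finiteDimensional hint
  haveI := finiteDimensional_fixedField_stabilizer V P
  haveI : NumberField ↥(IntermediateField.fixedField (MulAction.stabilizer (absoluteGaloisGroup K) P) ⊔
      IntermediateField.adjoin K ({i} : Set (AlgebraicClosure K))) := NumberField.of_module_finite K _
  haveI : NumberField ↥(V.divisionField 2 ⊔ IntermediateField.adjoin K ({i} : Set (AlgebraicClosure K))) :=
    NumberField.of_module_finite K _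
  intro κP hκP
  exact classicalMuVanishes_of_isCyclotomic_of_le_noGrowth
    (sup_le_sup_right (AddKatoTwo.fixedField_stabilizer_le_divisionField_two V P) _) hμ κP hκP

end Generic

/-! ## §2 Per curve over `ℚ`, either sign: PFμ¹²(W) ⟹ (a) ∧ (b) for `ℚ(β)` ⟹ a narrow rung ⟹ narrow subfield models -/

section PerCurve

variable (W : WeierstrassCurve ℚ) [W.IsElliptic] [W.IsGloballyMinimal]

omit [W.IsGloballyMinimal] in
/-- **PFμ¹²(W) ⟹ KIDA-LITE'S NARROW DATA (a) ∧ (b) FOR THE CUBIC FIELD `ℚ(β)`**, per curve, EITHER sign of `Δ_W`, NO named fact: for `W` globally minimal, good ordinary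
at `2`, no rational `2`-torsion abscissa, every root `β` and every `i` with `i² = −1`: «`μ₂ = 0` for every cyclotomic `ℤ₂`-extension of `ℚ(W[2]) ⊔ ℚ⟮i⟯`»
implies (a) `μ₂ = 0` for every cyclotomic `ℤ₂`-extension `κP` of `ℚ(β)` AND (b) a BOUNDED NARROW DEFECT `ord₂ h⁺(ℚ(β)_n) ≤ ord₂ h(ℚ(β)_n) + D` along all their
layers (any `NumberField` instance) — descent to `ℚ(β, i)` (§1), and this seat's converse of Kida-lite
`classicalMu_and_narrowDefect_le_of_classicalMu_sup_adjoin_of_sq_eq_neg_one` (genus theory with signatures + Hasse's norm theorem). BSD is NOT proved by this.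
[cite: Iwasawa1973MuInvariants, Thm. 2 and Thm. 3, §3–§4] [cite: Gras2003, IV.4 (genus theory with signatures)] [cite: Omeara1963, §65D Thm. 65:23]
[cite: Washington1997, §13.3 Prop. 13.22–13.23] -/
theorem narrowMuData_of_classicalMu_divisionField_two_sup_adjoin
    (ht : ∀ x : ℚ, ¬ HasRationalTwoTorsionX W x) {i : AlgebraicClosure ℚ} (hi : i ^ 2 = -1)
    (hμ12 : ∀ κL : ZpExtension ↥(W.divisionField 2 ⊔ IntermediateField.adjoin ℚ ({i} : Set (AlgebraicClosure ℚ))) 2,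
      κL.IsCyclotomic → ClassicalMuVanishes κL)
    {β : AlgebraicClosure ℚ} (hβ : aeval β W.twoTorsionPolynomial.toPoly = 0) :
    ∃ D : ℕ, ∀ κP : ZpExtension ↥(IntermediateField.adjoin ℚ ({β} : Set (AlgebraicClosure ℚ))) 2, κP.IsCyclotomic →
      ClassicalMuVanishes κP ∧ ∀ n : ℕ, ∀ [NumberField ↥(κP.layer n)],
        padicValNat 2 (narrowClassNumber ↥(κP.layer n)) ≤ padicValNat 2 (classNumber ↥(κP.layer n)) + D := by
  obtain ⟨P, -, hF⟩ := AddKatoTwo.exists_geomTorsion_two_ne_zero_fixedField_stabilizer_eq_adjoin W hβ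
  -- `μ₂ = 0` for `ℚ̄^{Stab P} ⊔ ℚ⟮i⟯ = ℚ(β) ⊔ ℚ⟮i⟯` (descent from `ℚ(W[2]) ⊔ ℚ⟮i⟯`)
  have key := classicalMu_pointField_sup_adjoin_of_classicalMu_divisionField_two_sup_adjoin W P hi hμ12
  rw [hF] at key
  have key' : ∀ κP : ZpExtension ↥(IntermediateField.adjoin ℚ ({β} : Set (AlgebraicClosure ℚ)) ⊔
      IntermediateField.adjoin ℚ ({i} : Set (AlgebraicClosure ℚ))) 2, κP.IsCyclotomic → ClassicalMuVanishes κP := key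
  -- the converse of Kida-lite for `ℚ(β)(√−1)` (`[ℚ(β):ℚ] = 3` odd)
  haveI : FiniteDimensional ℚ ↥(IntermediateField.adjoin ℚ ({β} : Set (AlgebraicClosure ℚ))) :=
    IntermediateField.adjoin.finiteDimensional ((AlgebraicClosure.isAlgebraic ℚ).isAlgebraic β).isIntegral
  haveI : NumberField ↥(IntermediateField.adjoin ℚ ({β} : Set (AlgebraicClosure ℚ))) := NumberField.mk
  have h3 := finrank_adjoin_eq_three_of_forall_not_hasRationalTwoTorsionX W ht hβ
  have hodd : Odd (Module.finrank ℚ ↥(IntermediateField.adjoin ℚ ({β} : Set (AlgebraicClosure ℚ)))) := by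
    rw [h3]; decide
  have res := classicalMu_and_narrowDefect_le_of_classicalMu_sup_adjoin_of_sq_eq_neg_one
    (IntermediateField.adjoin ℚ ({β} : Set (AlgebraicClosure ℚ))) hodd hi key'
  rcases res.2 with ⟨D, hδ⟩
  refine ⟨D, fun κP hκP => ⟨res.1 κP hκP, ?_⟩⟩
  intro n inst
  exact @hδ κP hκP n inst

set_option maxHeartbeats 1000000 in
/-- **PFμ¹²(W) ⟹ A NARROW RANK RUNG OF `ℚ(β)` FIRES**, per curve, EITHER sign of `Δ_W` (`i² = −1`, `μ₂ = 0` for `ℚ(W[2]) ⊔ ℚ⟮i⟯`): some `m ≥ 0` with **`[Cl⁺(ℚ(β)_{m+1}) : (Cl⁺)²] = [Cl⁺(ℚ(β)_m) : (Cl⁺)²]`**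
for EVERY cyclotomic `ℤ₂`-extension of `ℚ(β)` (any `NumberField` instances) — the previous theorem through this seat's ledger iff `exists_narrowRung_anyRung_iff_narrowMuData`
(w2 GEN 11 completeness; Fukuda index `0` on every stratum, att-p5 g28). This is EXACTLY the hypothesis `hcert` of the narrow doors
`…CubicNarrowRankDoorModelsAnyRung.mazurMainConjecture_two_of_muIneqRel_of_narrowRung_anyRung`: the narrow rung follows from PFμ¹²(W).
BSD is NOT proved by this. [cite: Fukuda1994, Thm. 1 (2), p. 264] [cite: Washington1997, §13.3 Prop. 13.22–13.23] [cite: Iwasawa1973MuInvariants, §3] -/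
theorem exists_narrowRung_of_classicalMu_divisionField_two_sup_adjoin
    (hord : IsOrdinaryAt W 2) (ht : ∀ x : ℚ, ¬ HasRationalTwoTorsionX W x) {i : AlgebraicClosure ℚ} (hi : i ^ 2 = -1)
    (hμ12 : ∀ κL : ZpExtension ↥(W.divisionField 2 ⊔ IntermediateField.adjoin ℚ ({i} : Set (AlgebraicClosure ℚ))) 2,
      κL.IsCyclotomic → ClassicalMuVanishes κL)
    {β : AlgebraicClosure ℚ} (hβ : aeval β W.twoTorsionPolynomial.toPoly = 0) :
    ∃ m : ℕ, ∀ κP : ZpExtension ↥(IntermediateField.adjoin ℚ ({β} : Set (AlgebraicClosure ℚ))) 2, κP.IsCyclotomic →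
      ∀ [NumberField (κP.layer m)] [NumberField (κP.layer (m + 1))],
        (powMonoidHom (α := NarrowClassGroup (κP.layer (m + 1))) 2).range.index =
          (powMonoidHom (α := NarrowClassGroup (κP.layer m)) 2).range.index := by
  rcases narrowMuData_of_classicalMu_divisionField_two_sup_adjoin W ht hi hμ12 hβ with ⟨D, hD⟩
  have h' := (exists_narrowRung_anyRung_iff_narrowMuData W hord ht hβ).mpr
    ⟨D, fun κP hκP => ⟨(hD κP hκP).1, by have h2 := (hD κP hκP).2; intro n inst; exact @h2 n inst⟩⟩
  rcases h' with ⟨m, hm⟩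
  exact ⟨m, fun κP hκP i1 i2 => @hm κP hκP i1 i2⟩

set_option maxHeartbeats 1000000 in
/-- **PFμ¹²(W) ⟹ THE NARROW MODELS CERTIFICATE**, per curve, EITHER sign of `Δ_W`: subfields `L = ℚ(β)_m ⊆ L' = ℚ(β)_{m+1}` of `ℚ(β)̄` of degrees `2^m`, `2^{m+1}` over
`ℚ(β)` with roots of `Ψ_m`, `Ψ_{m+1}` (`Ψ_0 = X`, `Ψ_{m+1} = Ψ_m² − 2`) and **`[Cl⁺(L') : (Cl⁺)²] = [Cl⁺(L) : (Cl⁺)²]`** (any `NumberField` structures) — the layers of one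
cyclotomic `ℤ₂`-extension ARE models (bsd-2adic `exists_iterate_root_layer_of_not_dvd_finrank`, `finrank_layer_holds`). BSD is NOT proved by this.
[cite: Fukuda1994, Thm. 1 (2), p. 264] [cite: Washington1997, §13.1] [cite: Iwasawa1973MuInvariants, §3] -/
theorem exists_narrow_subfield_models_of_classicalMu_divisionField_two_sup_adjoin
    (hord : IsOrdinaryAt W 2) (ht : ∀ x : ℚ, ¬ HasRationalTwoTorsionX W x) {i : AlgebraicClosure ℚ} (hi : i ^ 2 = -1)
    (hμ12 : ∀ κL : ZpExtension ↥(W.divisionField 2 ⊔ IntermediateField.adjoin ℚ ({i} : Set (AlgebraicClosure ℚ))) 2,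
      κL.IsCyclotomic → ClassicalMuVanishes κL)
    {β : AlgebraicClosure ℚ} (hβ : aeval β W.twoTorsionPolynomial.toPoly = 0) :
    ∃ (m : ℕ) (L L' : IntermediateField ↥(IntermediateField.adjoin ℚ ({β} : Set (AlgebraicClosure ℚ)))
        (AlgebraicClosure ↥(IntermediateField.adjoin ℚ ({β} : Set (AlgebraicClosure ℚ))))),
      Module.finrank ↥(IntermediateField.adjoin ℚ ({β} : Set (AlgebraicClosure ℚ))) L = 2 ^ m ∧
      Module.finrank ↥(IntermediateField.adjoin ℚ ({β} : Set (AlgebraicClosure ℚ))) L' = 2 ^ (m + 1) ∧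
      (∃ θ : L, (fun x : L => x ^ 2 - 2)^[m] θ = 0) ∧ (∃ θ' : L', (fun x : L' => x ^ 2 - 2)^[m + 1] θ' = 0) ∧
      ∀ [NumberField L] [NumberField L'],
        (powMonoidHom (α := NarrowClassGroup L') 2).range.index = (powMonoidHom (α := NarrowClassGroup L) 2).range.index := by
  haveI : Fact (Nat.Prime 2) := ⟨Nat.prime_two⟩
  haveI : FiniteDimensional ℚ ↥(IntermediateField.adjoin ℚ ({β} : Set (AlgebraicClosure ℚ))) :=
    IntermediateField.adjoin.finiteDimensional ((AlgebraicClosure.isAlgebraic ℚ).isAlgebraic β).isIntegral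
  haveI : NumberField ↥(IntermediateField.adjoin ℚ ({β} : Set (AlgebraicClosure ℚ))) := NumberField.mk
  have h3 := finrank_adjoin_eq_three_of_forall_not_hasRationalTwoTorsionX W ht hβ
  have hK : ¬ 2 ∣ Module.finrank ℚ ↥(IntermediateField.adjoin ℚ ({β} : Set (AlgebraicClosure ℚ))) := by rw [h3]; decide
  obtain ⟨κ, hκ, -⟩ := ZpExtension.exists_isCyclotomic_restrict_of_not_dvd_finrank (CyclotomicZp.zpExtension 2)
    (CyclotomicZp.isCyclotomic_zpExtension 2) ↥(IntermediateField.adjoin ℚ ({β} : Set (AlgebraicClosure ℚ))) hK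
  rcases exists_narrowRung_of_classicalMu_divisionField_two_sup_adjoin W hord ht hi hμ12 hβ with ⟨m, hm⟩
  refine ⟨m, κ.layer m, κ.layer (m + 1), κ.finrank_layer_holds m, κ.finrank_layer_holds (m + 1),
    exists_iterate_root_layer_of_not_dvd_finrank hK κ hκ m, exists_iterate_root_layer_of_not_dvd_finrank hK κ hκ (m + 1), ?_⟩
  intro i1 i2
  exact @hm κ hκ i1 i2

end PerCurve

/-! ## §3 Ledger: PFμ¹² ⟹ hNarrowModels ⟹ C2, both signs -/

set_option maxHeartbeats 1000000 in
/-- **PFμ¹² for every seed-cell curve ⟹ hNarrowModels, BOTH signs of `Δ_W`.** If for every globally minimal non-CM `W`, good ordinary at `2`, no rational `2`-torsion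
abscissa, `Δ_W ∉ ℚ²`, `r_an = 0`, `BSD₂(W)`, and every `i` with `i² = −1`, every cyclotomic `ℤ₂`-extension of `ℚ(W[2]) ⊔ ℚ⟮i⟯` has `μ = 0` (the hypothesis `hμ12` of
`…SmallCarrierRoad.mainConjectureOfRankZeroBSDAtTwo_of_muIneqRel_of_pointFieldMuCyc`), then every such `W` and every root `β` carry a model pair `L ⊆ L' ≤ ℚ(β)̄` at some rung
`m ≥ 0` with EQUAL NARROW `2`-ranks (§2 with `i = √−1 ∈ ℚ̄`). No named fact. BSD is NOT proved by this. [cite: Fukuda1994, Thm. 1 (2), p. 264] [cite: Iwasawa1973MuInvariants, §3–§4]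
[cite: Washington1997, §13.1 and §13.3] -/
theorem hNarrowModels_of_divisionFieldAdjoinIMu
    (hμ12 : ∀ (W : WeierstrassCurve ℚ) [W.IsElliptic] [W.IsGloballyMinimal], ¬ W.HasCM →
      IsOrdinaryAt W 2 → (∀ x : ℚ, ¬ HasRationalTwoTorsionX W x) → ¬ IsSquare W.Δ →
      W.analyticRank = 0 → BSDp W 2 →
      ∀ i : AlgebraicClosure ℚ, i ^ 2 = -1 →
      ∀ κL : ZpExtension ↥(W.divisionField 2 ⊔ IntermediateField.adjoin ℚ ({i} : Set (AlgebraicClosure ℚ))) 2,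
        κL.IsCyclotomic → ClassicalMuVanishes κL) :
    ∀ (W : WeierstrassCurve ℚ) [W.IsElliptic] [W.IsGloballyMinimal], ¬ W.HasCM →
      IsOrdinaryAt W 2 → (∀ x : ℚ, ¬ HasRationalTwoTorsionX W x) → ¬ IsSquare W.Δ →
      W.analyticRank = 0 → BSDp W 2 →
      ∀ β : AlgebraicClosure ℚ, aeval β W.twoTorsionPolynomial.toPoly = 0 →
      ∃ (m : ℕ) (L L' : IntermediateField ↥(IntermediateField.adjoin ℚ ({β} : Set (AlgebraicClosure ℚ)))
          (AlgebraicClosure ↥(IntermediateField.adjoin ℚ ({β} : Set (AlgebraicClosure ℚ))))),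
        Module.finrank ↥(IntermediateField.adjoin ℚ ({β} : Set (AlgebraicClosure ℚ))) L = 2 ^ m ∧
        Module.finrank ↥(IntermediateField.adjoin ℚ ({β} : Set (AlgebraicClosure ℚ))) L' = 2 ^ (m + 1) ∧
        (∃ θ : L, (fun x : L => x ^ 2 - 2)^[m] θ = 0) ∧ (∃ θ' : L', (fun x : L' => x ^ 2 - 2)^[m + 1] θ' = 0) ∧
        ∀ [NumberField L] [NumberField L'],
          (powMonoidHom (α := NarrowClassGroup L') 2).range.index = (powMonoidHom (α := NarrowClassGroup L) 2).range.index := by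
  intro W _ _ hcm hord ht hsq hr hbsd β hβ
  obtain ⟨i, hi⟩ : ∃ i : AlgebraicClosure ℚ, i ^ 2 = -1 := IsAlgClosed.exists_pow_nat_eq (-1) (by norm_num)
  have h12 : ∀ κL : ZpExtension ↥(W.divisionField 2 ⊔ IntermediateField.adjoin ℚ ({i} : Set (AlgebraicClosure ℚ))) 2,
      κL.IsCyclotomic → ClassicalMuVanishes κL := fun κL hκL => hμ12 W hcm hord ht hsq hr hbsd i hi κL hκL
  exact exists_narrow_subfield_models_of_classicalMu_divisionField_two_sup_adjoin W hord ht hi h12 hβ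

/-- **C2 `MainConjectureOfRankZeroBSDAtTwo` BY NAME ⟸ PRINT⁵ + MuIneqʳ + hNarrowModels on BOTH signs (ANY rung `m ≥ 0`).** PRINT⁵ = {Kato 17.4 (1)(2) at `2` (`hKato`),
Greenberg 4.1 (`hGr`), period unit (`hΩu`), modularity (`hmod`), GZK (`hGZK`)}; `hIneq` is the registered stub MuIneqʳ verbatim; `hNarrowModels`: per seed-cell curve (EITHER
sign of `Δ_W`) and root `β`, subfields `L ⊆ L'` of `ℚ(β)̄` of degrees `2^m`, `2^{m+1}` over `ℚ(β)` with roots of `Ψ_m`, `Ψ_{m+1}` and `[Cl⁺(L') : (Cl⁺)²] = [Cl⁺(L) : (Cl⁺)²]`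
(any `NumberField` structures) — this seat's `narrowMuData_of_subfield_models` (Fukuda index `0` everywhere, att-p5 g28) + att-p5 g24's Kida-lite road
`mazurMainConjecture_two_of_muIneqRel_of_narrowMu_cubicField`, legitimate on both signs; the 6th-currency ledger p761955 with its plain `Δ < 0` binder replaced by the narrow
one. The even-branch analytic binder of C2 is not used (tree `AnalyticMuTwo.red_ne_zero_…`). CONDITIONAL; the item stays open; BSD is NOT proved by this.
[cite: Fukuda1994, Thm. 1 (2), p. 264] [cite: Washington1997, §13.1] [cite: Kato2004Asterisque, Thm. 17.4 (p. 273) and §17.13 (pp. 279–280)]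
[cite: GreenbergLNM1716, Thm. 4.1 (p. 102), Conj. 1.11 (p. 58)] [cite: Kida1982JFields, main theorem (μ-part; shape only)] [cite: Iwasawa1973MuInvariants, Thm. 2 and Thm. 3, §4] -/
theorem mainConjectureOfRankZeroBSDAtTwo_of_named_inputs_narrowModels_bothSigns
    (hKato : ∀ (W : WeierstrassCurve ℚ) [W.IsElliptic] [W.IsGloballyMinimal] ⦃N : ℕ⦄ [NeZero N]
      (f : CuspForm (Gamma0 N) 2), kato_divisibility_allPrimes W 2 (f := f))
    (hGr : Greenberg1999.thm41_charValue_rankZero_anyPrime)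
    (hΩu : realPeriodRat_eq_unit_mul_plusPeriod_two) (hmod : nonempty_modularParametrizationData)
    (hGZK : rank_eq_analyticRank_of_analyticRank_le_one)
    (hIneq : ∀ (W : WeierstrassCurve ℚ) [W.IsElliptic] [W.IsGloballyMinimal], IsOrdinaryAt W 2 →
      (∀ x : ℚ, ¬ HasRationalTwoTorsionX W x) →
      ∀ (κ : ZpExtension ℚ 2) (γ : Field.absoluteGaloisGroup ℚ), κ.IsCyclotomic →
      κ.IsTopGenerator γ → IsCyclotomicVariable 2 γ →
      ∀ ⦃N : ℕ⦄ [NeZero N] (f : CuspForm (Gamma0 N) 2), IsNewformOf W f →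
      ∀ Gp : IwasawaAlgebra 2, iwasawaToPowerSeries 2 Gp = padicLFunction f (unitRoot W 2 : ℚ_[2]) →
      ∀ (D : W.SelmerDualData κ γ) (Yr : W.FineSelmerDualDataRelaxedInf κ γ),
        lengthAt (IwasawaAlgebra 2) D.X ⟨IwasawaAlgebra.augIdealP 2, IwasawaAlgebra.isPrime_augIdealP_holds 2⟩ ≤
          lengthAt (IwasawaAlgebra 2) (IwasawaAlgebra 2 ⧸ Ideal.span {Gp})
              ⟨IwasawaAlgebra.augIdealP 2, IwasawaAlgebra.isPrime_augIdealP_holds 2⟩ +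
            lengthAt (IwasawaAlgebra 2) Yr.X ⟨IwasawaAlgebra.augIdealP 2, IwasawaAlgebra.isPrime_augIdealP_holds 2⟩)
    (hNarrowModels : ∀ (W : WeierstrassCurve ℚ) [W.IsElliptic] [W.IsGloballyMinimal], ¬ W.HasCM →
      IsOrdinaryAt W 2 → (∀ x : ℚ, ¬ HasRationalTwoTorsionX W x) → ¬ IsSquare W.Δ →
      W.analyticRank = 0 → BSDp W 2 →
      ∀ β : AlgebraicClosure ℚ, aeval β W.twoTorsionPolynomial.toPoly = 0 →
      ∃ (m : ℕ) (L L' : IntermediateField ↥(IntermediateField.adjoin ℚ ({β} : Set (AlgebraicClosure ℚ)))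
          (AlgebraicClosure ↥(IntermediateField.adjoin ℚ ({β} : Set (AlgebraicClosure ℚ))))),
        Module.finrank ↥(IntermediateField.adjoin ℚ ({β} : Set (AlgebraicClosure ℚ))) L = 2 ^ m ∧
        Module.finrank ↥(IntermediateField.adjoin ℚ ({β} : Set (AlgebraicClosure ℚ))) L' = 2 ^ (m + 1) ∧
        (∃ θ : L, (fun x : L => x ^ 2 - 2)^[m] θ = 0) ∧ (∃ θ' : L', (fun x : L' => x ^ 2 - 2)^[m + 1] θ' = 0) ∧
        ∀ [NumberField L] [NumberField L'],
          (powMonoidHom (α := NarrowClassGroup L') 2).range.index = (powMonoidHom (α := NarrowClassGroup L) 2).range.index) :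
    MainConjectureOfRankZeroBSDAtTwo := by
  intro W _ _ hcm hord ht hsq hr hμan hbsd
  obtain ⟨β, hβ⟩ := AddKatoTwo.exists_aeval_twoTorsionPolynomial_eq_zero W
  haveI : FiniteDimensional ℚ ↥(IntermediateField.adjoin ℚ ({β} : Set (AlgebraicClosure ℚ))) :=
    IntermediateField.adjoin.finiteDimensional ((AlgebraicClosure.isAlgebraic ℚ).isAlgebraic β).isIntegral
  haveI : NumberField ↥(IntermediateField.adjoin ℚ ({β} : Set (AlgebraicClosure ℚ))) := NumberField.mk
  have h3 := finrank_adjoin_eq_three_of_forall_not_hasRationalTwoTorsionX W ht hβ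
  obtain ⟨m, L, L', hL, hL', hθ, hθ', hnarrow⟩ := hNarrowModels W hcm hord ht hsq hr hbsd β hβ
  obtain ⟨hμ, D, hδ⟩ := narrowMuData_of_subfield_models (by rw [h3]; decide)
    (fun κP hκP => (totallyRamifiedFrom_zero_adjoin_of_isOrdinaryAt_two W hord ht hβ κP hκP).mono (Nat.zero_le m))
    L L' hL hL' hθ hθ' hnarrow
  exact mazurMainConjecture_two_of_muIneqRel_of_narrowMu_cubicField W (fun f => hKato W f) hGr hΩu hmod hGZK hIneq hord ht hr hμan
    hbsd hβ hμ D (fun κP hκP n inst => @hδ κP hκP n inst)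

end Summit.BirchSwinnertonDyer.BirchSwinnertonDyer.Theorems.AlignedTransportAtTwoRouteLedgerNarrowModelsFromAdjoinIMu

end
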